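import Summits.ABC.ABC.Theses.LopsidedSzpiroSplit
import Literature.NumberTheory.EllipticCurves.Szpiro
import Literature.NumberTheory.EllipticCurves.IsogenyTwoTorsionProofs

/-!
# Birth skeleton (BC3) — crux `SexticABC` (stmt-ABC-18361), route `LopsidedSzpiroSplit`

Route `route-ABC-LopsidedSzpiroSplit` (ABC/ABC); crux decl
`Summit.ABC.ABC.Theses.LopsidedSzpiroSplit.SexticABC` (rank 3):

  `∀ ε > 0, ∃ K > 0, ∀ abc triples (a,b,c), a·b·c⁴ < K · rad(abc)^(6+ε)`

— Szpiro's conjecture with exponent `6 + ε` for the `2`-isogenous codomain `E′` of the Frey curve,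
"in elementary currency" (route header; Silverman AEC 2009 Ex. 8.20, Oesterlé 1988 §2 Remarque (Szpiro)).

## The line (the route's own two-layer plan `SexticABC ⇐ SzpiroPrime → PrimeLocalData`), re-typed

* `stub_szpiroFreyIsog` (OPEN, conjecture-grade, the load-bearing stub): Szpiro `(6+ε)` in the tree's
  `minimalDiscriminantNorm ℤ / conductorNorm ℤ` currency for every elliptic Weierstrass model over `ℚ`
  that is `ℚ`-isomorphic (`VariableChange`) to a Frey `2`-isogeny codomain
  `(freyCurve A B).twoIsogenyCodomain` with `A, B` coprime integers — i.e. Szpiro's conjecture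
  restricted to the Frey–Hellegouarch `2`-isogeny class (all three `2`-quotients of every Frey curve
  `y² = x(x−A)(x+B)` occur, by re-arranging `(A, B)`).  Instantly implied by
  `Literature.NumberTheory.EllipticCurves.SzpiroConjecture`; no unconditional polynomial bound
  `|Δ_min| ≪ N^k` is known for any non-isotrivial family over `ℚ` (why it might fail: it does not —
  the bet is that the explicit family is more tractable than all `E/ℚ`; `ε = 0` is false, Masser).
* `stub_freyIsogLocalData` (PROVABLE NOW, M-sized; Silverman AEC Ex. 8.20(b) / Oesterlé p. 168 in the
  `a·b·c⁴` weighting): absolute constants `A₀, B₀` such that every abc triple `(a,b,c)` carries SOME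
  model `W` in that class with `a·b·c⁴ ≤ A₀ · |Δ_min(W)|` and `N(W) ≤ B₀ · rad(abc)`.  Proof plan: the
  signed arrangement of `Literature.NumberTheory.EllipticCurves.exists_arrangement_odd/_isog` (an ODD
  member `z ≥ c/2` in the fourth-power slot, so `|AB(A+B)⁴| = abc·z³ ≥ a·b·c⁴/8`), the global minimal
  integral models `freyIsogModel` (`Δ = −2⁸AB(A+B)⁴`, `N ∣ 2¹² rad`) and `freyIsogModel₂`
  (Serre-normalised, `16 ∣ abc`: `Δ = −AB(A+B)⁴/2⁴`, `N ∣ rad`) of `SzpiroSixFifthsProofs`,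
  `minimalDiscriminantNorm_eq_natAbs_holds`, and the explicit variable change (`x = 4X + r`,
  `y = 8Y + 4X`) identifying the normalised model with `φ • (freyCurve A B).twoIsogenyCodomain`;
  gives `A₀ = 2⁷`, `B₀ = 2¹²`.

Why the `∃ W`-per-triple / `VariableChange`-class typing instead of pinning
`W = (freyCurve a b).twoIsogenyCodomain` (the superseded 2026-08-17T16:01 registration): with `c` in
the fourth-power slot and `c` even, the literal model `y² = x³ − 2(b−a)x² + c²x` is not minimal at `2`
(`v₂(Δ) = 8 + 4·v₂(c) ≥ 12`, `v₂(c₄) ≥ 6`), so its `|Δ_min|` and the `2`-part of its conductor are out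
of reach of the tree's proved local dictionary (`SzpiroLocalDataProofs`, `SzpiroMinimalityProofs`) and
would need the UNPROVED named facts `WeierstrassCurve.minimalDiscriminantIdeal_smul` /
`conductorExponent_le_eight` (Brumer–Kramer); the in-tree Oesterlé argument
(`abc_sixFifths_of_szpiro_holds`) works model-by-model and dodges exactly this by the odd-member
arrangement.  Szpiro is a statement about isomorphism classes anyway, so quantifying the hard stub
over all models `φ • E′` loses nothing.

Assembly (registrar shape, as in `Cruxes/BalancedFamily/Lines/birth.lean`):
`SexticABC_of_stubs : <stub₁-sig> → <stub₂-sig> → <body of SexticABC, verbatim>` is a REAL proof (pure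
`rpow` bookkeeping: `a·b·c⁴ ≤ A₀|Δ_min(W)| ≤ A₀·max(C,0)·N(W)^(6+ε) ≤ A₀·max(C,0)·B₀^(6+ε)·rad^(6+ε)
< (A₀·max(C,0)·B₀^(6+ε) + 1)·rad^(6+ε)`), and `SexticABC_of : SexticABC := SexticABC_of_stubs stub₁ stub₂`
concludes the crux BY NAME with no hypotheses; `sorry` occurs ONLY in the two `stub_*` theorems, which are
exactly the sorried declarations in the closure of `SexticABC_of`.

BC3 probes (planner folder `bc/stub1_probe.lean`, `bc/stub2_probe.lean`, `bc/diag_exact_stub{1,2}.lean`,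
farm 2026-08-17, skeleton NOT imported — each stub statement inlined verbatim as an `abbrev`): for each
stub `S`, `example : S → SexticABC` and `example : S → _root_.ABC` by
`first | exact? | simpa | simpa [SexticABC] | (unfold SexticABC; simpa) | aesop | (unfold …; aesop)`
FAIL (4/4: rc 1, `unsolved goals ⊢ SexticABC` / `⊢ ABC`, `aesop: failed to prove the goal after
exhaustive search`; `exact?` alone: "`exact?` could not close the goal" 4/4), while the controls close
(`S → S`; library-search health `n < n.succ` by `exact?`; `SzpiroConjecture → stub₁` by a 3-line term).
Informational: `example : S := by exact?` fails for both stubs (not in-tree; dedup clean) and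
`SexticABC → stub₁` does not close cheaply either.  No stub is cheaply the crux or the summit.

Disproof used: none exists for this crux (`ledger crux ls stmt-ABC-18361`: no workfiles, 2026-08-17).
Refuter birth attack (Evidence.lean, 2026-08-17T16:17Z): `ABC → SexticABC` and
`SexticABC → (c⁵ < K·rad^(6+ε))` — consistent with this line (stub 1 ⇐ SzpiroConjecture ⇐ abc).
Negatives index (ABC): stmt-ABC-1205, stmt-ABC-1689 — unrelated to either stub.
-/

-- `Summit.<Summit>.<Problem>`: for the single-conjunct summit `ABC` the duplicate `ABC.ABC` is mandated.
set_option linter.dupNamespace false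

namespace Summit.ABC.ABC.Cruxes.SexticABC.Birth

open Literature.NumberTheory.DiophantineGeometry
open Literature.NumberTheory.EllipticCurves
open Summit.ABC.ABC.Theses.LopsidedSzpiroSplit

/-! ## The registered stubs -/

/-- **Stub 1 (OPEN; conjecture-grade; load-bearing).** Szpiro's conjecture with exponent `6 + ε` for
the Frey–Hellegouarch `2`-isogeny class: for every `ε > 0` there is `C` such that every elliptic
Weierstrass model `W / ℚ` that is `ℚ`-isomorphic to `(freyCurve A B).twoIsogenyCodomain`
(`E′ : y² = x³ − 2(B−A)x² + (A+B)²x`, `Δ = −2⁸·AB·(A+B)⁴`) for some coprime integers `A, B` satisfies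
`|Δ_min(W)| ≤ C · N(W)^(6+ε)`.  Implied by `SzpiroConjecture` (Silverman AEC Conj. VIII.11.1);
why it might fail: conjecture-grade — no polynomial discriminant–conductor bound is known for any
non-isotrivial family over `ℚ` (log-forms give exponential Szpiro only, Stewart–Yu 2001); `ε = 0`
is false in general (Masser; `Literature.Barriers.ABC.SzpiroEpsilonCannotBeDropped`).
Sources: SilvermanAEC2009 Conj. VIII.11.1 + Ex. 8.20; Oesterle1988 §2; Masser2002; StewartYu2001. -/
theorem stub_szpiroFreyIsog :
    ∀ ε : ℝ, 0 < ε → ∃ C : ℝ, ∀ (W : WeierstrassCurve ℚ) [W.IsElliptic],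
      (∃ (A B : ℤ) (φ : WeierstrassCurve.VariableChange ℚ), IsCoprime A B ∧
          W = φ • (freyCurve A B).twoIsogenyCodomain) →
        ((W.minimalDiscriminantNorm ℤ : ℕ) : ℝ) ≤ C * ((W.conductorNorm ℤ : ℕ) : ℝ) ^ (6 + ε) := by
  sorry

/-- **Stub 2 (PROVABLE NOW; M-sized local dictionary).** There are absolute constants `A₀, B₀ > 0`
such that every abc triple `(a, b, c)` admits an elliptic Weierstrass model `W / ℚ`, `ℚ`-isomorphic to
the Frey `2`-isogeny codomain `(freyCurve A B).twoIsogenyCodomain` of a SIGNED ARRANGEMENT `(A, B, A+B)`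
of the triple (`A, B` coprime, `|AB(A+B)| = abc`), whose minimal discriminant dominates the sextic
weight, `a·b·c⁴ ≤ A₀ · |Δ_min(W)|`, and whose conductor is at most `B₀ · rad(abc)`.  Plan: odd-member arrangement (`|AB(A+B)⁴| ≥ a·b·c⁴/8`) + the global minimal models
`freyIsogModel` / `freyIsogModel₂` of `SzpiroSixFifthsProofs` (`A₀ = 2⁷`, `B₀ = 2¹²`); why it might
fail: only through a mis-typing (it is Silverman AEC Ex. 8.20(b) / Oesterlé 1988 p. 168 with the
`c⁵`-inequality replaced by `a·b·c⁴ ≤ 8·abc·z³`).  Sources: SilvermanAEC2009 Ex. 8.20(b);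
Oesterle1988 §2 Remarque (Szpiro), p. 168; in-tree `exists_minimal_isog_model`. -/
theorem stub_freyIsogLocalData :
    ∃ A₀ B₀ : ℝ, 0 < A₀ ∧ 0 < B₀ ∧ ∀ a b c : ℕ, IsABCTriple a b c →
      ∃ W : WeierstrassCurve ℚ, W.IsElliptic ∧
        (∃ (A B : ℤ) (φ : WeierstrassCurve.VariableChange ℚ), IsCoprime A B ∧
            (A * B * (A + B)).natAbs = a * b * c ∧ W = φ • (freyCurve A B).twoIsogenyCodomain) ∧
        ((a * b * c ^ 4 : ℕ) : ℝ) ≤ A₀ * ((W.minimalDiscriminantNorm ℤ : ℕ) : ℝ) ∧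
        ((W.conductorNorm ℤ : ℕ) : ℝ) ≤ B₀ * ((rad a b c : ℕ) : ℝ) := by
  sorry

/-! ## Assembly (sorry-free) -/

/-- **ASSEMBLY (kernel-checked, no `sorry`).** The two stub statements imply the crux statement
(verbatim the body of `Summit.ABC.ABC.Theses.LopsidedSzpiroSplit.SexticABC`): for `ε > 0` take `C` from stub 1 and
`A₀, B₀` from stub 2 and put `K := A₀ · max C 0 · B₀^(6+ε) + 1`; for an abc triple pick the model `W`
of stub 2, so `a·b·c⁴ ≤ A₀|Δ_min(W)| ≤ A₀·max(C,0)·N(W)^(6+ε) ≤ A₀·max(C,0)·(B₀·rad)^(6+ε) < K·rad^(6+ε)`.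
[folklore] -/
theorem SexticABC_of_stubs
    (h₁ : ∀ ε : ℝ, 0 < ε → ∃ C : ℝ, ∀ (W : WeierstrassCurve ℚ) [W.IsElliptic],
      (∃ (A B : ℤ) (φ : WeierstrassCurve.VariableChange ℚ), IsCoprime A B ∧
          W = φ • (freyCurve A B).twoIsogenyCodomain) →
        ((W.minimalDiscriminantNorm ℤ : ℕ) : ℝ) ≤ C * ((W.conductorNorm ℤ : ℕ) : ℝ) ^ (6 + ε))
    (h₂ : ∃ A₀ B₀ : ℝ, 0 < A₀ ∧ 0 < B₀ ∧ ∀ a b c : ℕ, IsABCTriple a b c →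
      ∃ W : WeierstrassCurve ℚ, W.IsElliptic ∧
        (∃ (A B : ℤ) (φ : WeierstrassCurve.VariableChange ℚ), IsCoprime A B ∧
            (A * B * (A + B)).natAbs = a * b * c ∧ W = φ • (freyCurve A B).twoIsogenyCodomain) ∧
        ((a * b * c ^ 4 : ℕ) : ℝ) ≤ A₀ * ((W.minimalDiscriminantNorm ℤ : ℕ) : ℝ) ∧
        ((W.conductorNorm ℤ : ℕ) : ℝ) ≤ B₀ * ((rad a b c : ℕ) : ℝ)) :
    ∀ ε : ℝ, 0 < ε → ∃ K : ℝ, 0 < K ∧ ∀ a b c : ℕ, IsABCTriple a b c →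
      ((a * b * c ^ 4 : ℕ) : ℝ) < K * ((rad a b c : ℕ) : ℝ) ^ (6 + ε) := by
  intro ε hε
  obtain ⟨C, hC⟩ := h₁ ε hε
  obtain ⟨A₀, B₀, hA₀, hB₀, hloc⟩ := h₂
  have hM : (0 : ℝ) ≤ max C 0 := le_max_right _ _
  have hBpow : (0 : ℝ) < B₀ ^ (6 + ε) := Real.rpow_pos_of_pos hB₀ _
  refine ⟨A₀ * max C 0 * B₀ ^ (6 + ε) + 1, by positivity, ?_⟩
  intro a b c habc
  obtain ⟨W, hE, ⟨A, B, φ, hAB, -, hW⟩, hdisc, hcond⟩ := hloc a b c habc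
  haveI := hE
  have hSz := hC W ⟨A, B, φ, hAB, hW⟩
  have hradne : rad a b c ≠ 0 := by
    rw [rad_def]
    exact UniqueFactorizationMonoid.radical_ne_zero
  have hR1 : (1 : ℝ) ≤ ((rad a b c : ℕ) : ℝ) := by
    exact_mod_cast Nat.one_le_iff_ne_zero.mpr hradne
  set D : ℝ := ((W.minimalDiscriminantNorm ℤ : ℕ) : ℝ) with hDdef
  set N : ℝ := ((W.conductorNorm ℤ : ℕ) : ℝ) with hNdef
  set R : ℝ := ((rad a b c : ℕ) : ℝ) with hRdef
  have hN0 : (0 : ℝ) ≤ N := by positivity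
  have hR0 : (0 : ℝ) < R := lt_of_lt_of_le one_pos hR1
  have hRpow : (0 : ℝ) < R ^ (6 + ε) := Real.rpow_pos_of_pos hR0 _
  -- `|Δ_min| ≤ max(C,0) · N^(6+ε)`
  have h1 : D ≤ max C 0 * N ^ (6 + ε) :=
    hSz.trans (mul_le_mul_of_nonneg_right (le_max_left _ _) (by positivity))
  -- `N^(6+ε) ≤ B₀^(6+ε) · R^(6+ε)`
  have h2 : N ^ (6 + ε) ≤ B₀ ^ (6 + ε) * R ^ (6 + ε) := by
    rw [← Real.mul_rpow hB₀.le hR0.le]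
    exact Real.rpow_le_rpow hN0 hcond (by linarith)
  have h3 : max C 0 * N ^ (6 + ε) ≤ max C 0 * (B₀ ^ (6 + ε) * R ^ (6 + ε)) :=
    mul_le_mul_of_nonneg_left h2 hM
  calc ((a * b * c ^ 4 : ℕ) : ℝ) ≤ A₀ * D := hdisc
    _ ≤ A₀ * (max C 0 * N ^ (6 + ε)) := mul_le_mul_of_nonneg_left h1 hA₀.le
    _ ≤ A₀ * (max C 0 * (B₀ ^ (6 + ε) * R ^ (6 + ε))) := mul_le_mul_of_nonneg_left h3 hA₀.le
    _ = (A₀ * max C 0 * B₀ ^ (6 + ε)) * R ^ (6 + ε) := by ring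
    _ < (A₀ * max C 0 * B₀ ^ (6 + ε) + 1) * R ^ (6 + ε) := by nlinarith

/-- **THE SKELETON THEOREM (registrar shape).** The crux
`Summit.ABC.ABC.Theses.LopsidedSzpiroSplit.SexticABC`, concluded BY NAME from the two declared stubs
through the sorry-free assembly `SexticABC_of_stubs` (whose hypotheses are literally the stub signatures
and whose conclusion is the body of `SexticABC` verbatim); the only `sorry`s in its closure are
`stub_szpiroFreyIsog` and `stub_freyIsogLocalData`. [folklore] -/
theorem SexticABC_of : SexticABC :=
  SexticABC_of_stubs stub_szpiroFreyIsog stub_freyIsogLocalData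

end Summit.ABC.ABC.Cruxes.SexticABC.Birth
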